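import Literature.Analysis.FluidPDE.NSLerayBlowupRateTopHolds
import Literature.Analysis.FluidPDE.NSCriticalClosureProofs
import Literature.Analysis.FluidPDE.TaoLocalisationHolds
import HarnessLib

/-!
# Route TypeICertificateLadder — `RungZero` (item stmt-NavierStokesRegularity-2886)

RUNG ZERO of the Type-I certificate ladder (Leray 1934, §19 (3.8)–(3.9), p. 224; Ożański–Pooley
2018, Cor. 6.25): some positive "collapse Reynolds number" `C₀` is excluded — a classical solution
of the unforced Navier–Stokes system on `ℝ³ × [0, T)` which is Leray–Hopf from its rapidly
decaying datum and satisfies `√(T - t) ‖u(t, x)‖ ≤ C₀ √ν` for all `x` and all `t < T` near `T`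
extends smoothly past `T`.

The statement is the item's Prop **verbatim**; this module imports NO route (`Theses`) file, so
that a `_holds` link may import it into the route file without an import cycle (landing note of
the route-repair planner on `Theses/TypeICertificateLadder.lean`, 2026-08-15T22:31Z; pattern of
`Theorems/NoBlowupToClay.lean`).

## Proof (every input is a theorem of the tree)

Let `c > 0` be the universal constant of Leray's lower rate
`Literature.Analysis.FluidPDE.leray_blowup_rate_top` — discharged as
`leray_blowup_rate_top_holds` (`NSLerayBlowupRateTopHolds.lean`): a maximal smooth solution with
lifespan `T` which is Leray–Hopf from `u(0)` and essentially bounded on every closed sub-strip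
`[0, T'] × ℝ³`, `T' < T`, has `‖u(t)‖_{L^∞} ≥ c √ν / √(T - t)` for every `t ∈ [0, T)`.
Take `C₀ := c / 2`. If `u` did not extend past `T`, `(u, p)` would be a maximal smooth solution
(`IsMaximalSmoothSolution` := classical on `Ico 0 T` ∧ no extension); the sub-strip boundedness is
Tao 2013, Cor. 11.1 (+ Cor. 4.3, Thm. 5.4 (iv)) with the Sobolev imbedding, in the tree
`eLpNorm_uncurry_top_lt_top_of_tao2011` fed with the discharged
`tao2011_hasBoundedSobolevNormsOn_holds`. Pick `t ∈ [0, T)` in the eventual set of the rate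
hypothesis (`𝓝[<] T` is non-trivial): the pointwise bound `‖u(t, x)‖ ≤ (c/2) √ν / √(T - t)` gives
`‖u(t)‖_{L^∞} ≤ (c/2) √ν / √(T - t) < c √ν / √(T - t) ≤ ‖u(t)‖_{L^∞}` — absurd.

References: J. Leray, Acta Math. 63 (1934), §19 (3.8)–(3.9); W. S. Ożański, B. C. Pooley,
*Leray's fundamental work on the Navier–Stokes equations: a modern review* (2018), Cor. 6.25;
T. Tao, Anal. PDE 6 (2013), Cor. 11.1.
-/

noncomputable section

open MeasureTheory TopologicalSpace Set Function Filter
open _root_.Topology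
open scoped ENNReal NNReal
open Literature.Analysis.FluidPDE

namespace Summit.NavierStokesRegularity.NavierStokesRegularity.Theorems

/-- **Rung zero of the Type-I certificate ladder** (item stmt-NavierStokesRegularity-2886,
verbatim; Leray 1934, §19 (3.9)): there is `C > 0` such that every classical solution of the
unforced Navier–Stokes system on `ℝ³ × [0, T)` (`ν, T > 0`) which is Leray–Hopf on `[0, T]` from
its rapidly decaying datum and obeys the eventual dimensionless rate
`√(T - t) ‖u(t, x)‖ ≤ C √ν` (all `x`, all `t < T` close to `T`) extends smoothly past `T`.
Proof: `C := c/2`, `c` the constant of `leray_blowup_rate_top_holds`; a non-extending solution is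
maximal, bounded on closed sub-strips by `eLpNorm_uncurry_top_lt_top_of_tao2011`
(`tao2011_hasBoundedSobolevNormsOn_holds`), and at a time `t < T` of the eventual set
`‖u(t)‖_∞ ≤ (c/2)√ν/√(T-t)` contradicts Leray's `c√ν/√(T-t) ≤ ‖u(t)‖_∞`. -/
theorem typeICertificateLadder_rungZero :
    ∃ C : ℝ, 0 < C ∧ ∀ (ν T : ℝ), 0 < ν → 0 < T → ∀ (u : ℝ → EuclideanSpace ℝ (Fin 3) → EuclideanSpace ℝ (Fin 3)) (p : ℝ → EuclideanSpace ℝ (Fin 3) → ℝ), Literature.Analysis.FluidPDE.IsClassicalNSSolutionOn (Set.Ico 0 T) ν 0 u p → Literature.Analysis.FluidPDE.IsLerayHopfOn T ν 0 (u 0) u → Literature.Analysis.FluidPDE.HasRapidSpatialDecay (u 0) → (∀ᶠ t in 𝓝[<] T, ∀ x, Real.sqrt (T - t) * ‖u t x‖ ≤ C * Real.sqrt ν) → Literature.Analysis.FluidPDE.HasSmoothExtensionPast ν 0 u T := by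
  obtain ⟨c, hc, hrate⟩ := leray_blowup_rate_top_holds
  refine ⟨c / 2, by positivity, ?_⟩
  intro ν T hν hT u p hsol hLH hdec hev
  by_contra hext
  -- a non-extending classical solution is a maximal smooth solution with lifespan `T`
  have hmax : IsMaximalSmoothSolution ν 0 u p T := ⟨hsol, hext⟩
  -- bounded on every closed sub-strip `[0, T'] × ℝ³` (Tao 2013, Cor. 11.1 + Sobolev)
  have hbdd : ∀ T' ∈ Ioo 0 T, eLpNorm (uncurry u) ∞
      ((volume : Measure (ℝ × EuclideanSpace ℝ (Fin 3))).restrict (Icc 0 T' ×ˢ univ)) < ∞ :=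
    eLpNorm_uncurry_top_lt_top_of_tao2011 tao2011_hasBoundedSobolevNormsOn_holds hν hsol hLH hdec
  -- Leray's lower rate along `[0, T)`
  have hr := hrate ν T hν hT u p hmax hLH hbdd
  -- a time `t ∈ [0, T)` at which the eventual upper rate holds
  have hIco : ∀ᶠ t in 𝓝[<] T, t ∈ Ico (0 : ℝ) T := Ico_mem_nhdsLT hT
  obtain ⟨t, ht, hrt⟩ := (hIco.and hev).exists
  have hTt : 0 < T - t := sub_pos.2 ht.2
  have hsq : 0 < Real.sqrt (T - t) := Real.sqrt_pos.2 hTt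
  -- pointwise: `‖u t x‖ ≤ (c/2) √ν / √(T - t)`
  have hM : ∀ x, ‖u t x‖ ≤ c / 2 * Real.sqrt ν / Real.sqrt (T - t) := by
    intro x
    rw [le_div_iff₀ hsq]
    have h := hrt x
    linarith [mul_comm (Real.sqrt (T - t)) ‖u t x‖]
  -- hence `‖u t‖_∞ ≤ (c/2) √ν / √(T - t)`
  have h2 : eLpNorm (u t) ∞ volume ≤ ENNReal.ofReal (c / 2 * Real.sqrt ν / Real.sqrt (T - t)) := by
    rw [eLpNorm_exponent_top]
    exact eLpNormEssSup_le_of_ae_bound (Eventually.of_forall hM)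
  have hpos : 0 ≤ c / 2 * Real.sqrt ν / Real.sqrt (T - t) := by positivity
  -- Leray: `c √ν / √(T - t) ≤ ‖u t‖_∞`; combine
  have h4 : c * Real.sqrt ν / Real.sqrt (T - t) ≤ c / 2 * Real.sqrt ν / Real.sqrt (T - t) :=
    (ENNReal.ofReal_le_ofReal_iff hpos).1 ((hr t ht).trans h2)
  have h5 := mul_le_mul_of_nonneg_right h4 hsq.le
  rw [div_mul_cancel₀ _ hsq.ne', div_mul_cancel₀ _ hsq.ne'] at h5
  have hK : 0 < c * Real.sqrt ν := mul_pos hc (Real.sqrt_pos.2 hν)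
  linarith

end Summit.NavierStokesRegularity.NavierStokesRegularity.Theorems

end
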